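import Summits.CriticalPhenomena.PercolationContinuityZ3.Theorems.SahiAEBandPatch
import Summits.CriticalPhenomena.PercolationContinuityZ3.Theorems.SahiAEPlanePrelim

/-!
# The band theorem, shift step: tensor splitting of the base correction and the line-correction cocycle

Support file of the Sahi cell (`prim-sahi`, typer seat, generation 24; `--supports stmt-CriticalPhenomena-4575`).
Theorems only (no definitions, no named facts, no sorries).

Setting of `SahiAEBandPatch.lean`: `φ : ℝ^ι → ℝ` measurable, `ψ = patch φ j` the patched function of a rational
box `K_j` (supermodular on a.e. pair of `ℝ^ι`, `= φ` on `K_j`), line factors `Lᵢ^{c,c'}(x) = exp(ψ(c;i:=xᵢ) − ψ(c';i:=xᵢ))`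
and line corrections `Λᵢ^{c,c'} = log cornerEnvelope Lᵢ − log Lᵢ` (`SahiAEBandPrelim.lean`).

* `ae_monotone_lineProfile` — for a pair of base points generic in direction `i` with `c' ≤ c` off `i`, increasing
  differences make the profile of `Lᵢ^{c,c'}` non-decreasing on almost every comparable pair of reals; hence
  `Lᵢ` is a.e.-monotone on `ℝ^ι` with finite corner essential suprema and a version-envelope
  (`lineCorrection_patch_ae_eq_zero`: `Λᵢ = 0` a.e.).
* **Cocycle** (`lineCorrection_add`): for three base points `c, c', c''` decreasing off `i` and pairwise generic in
  direction `i`, `Λᵢ^{c,c''} = Λᵢ^{c,c'} + Λᵢ^{c',c''}` at EVERY point near which the three axis sections lie in `K_j`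
  (product formula `cornerEnvelope_mul_of_ae_monotone` + locality) — stated for `φ` itself.
* **Tensor split in the plane** (`ι = Fin 2`): the base factor `exp(S_c − S_{c'})` of `SahiAEOrthantShift.lean` is
  `L₀ · L₁ · e^{−(ψ(c) − ψ(c'))}` (`baseFactor_eq_lineFactor_mul`), its envelope splits accordingly
  (`cornerEnvelope_baseFactor_eq`), and the base correction is the SUM of the two line corrections of `φ`
  (`baseCorrection_patch_eq`); with `boxVersion_shift` this gives the planar shift identity
  `boxVersion φ c' p = boxVersion φ c p + Λ₀^{c,c'}(p) + Λ₁^{c,c'}(p)` (`Plane.boxVersion_shift_eq`), in which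
  `Λ₀^{c,c'}(p)` only depends on the HEIGHTS `c₁, c'₁` and on `p₀`, and `Λ₁^{c,c'}(p)` on `c₀, c'₀, p₁`.

No sorries, no new axioms.
-/

noncomputable section

namespace Summit.CriticalPhenomena.PercolationContinuityZ3.Theorems.SahiAEFourFunctions

open MeasureTheory Set Filter Topology Function
open scoped ENNReal NNReal

variable {ι : Type*} [Fintype ι] [DecidableEq ι]

/-! ### Monotone line profiles from generic pairs -/

omit [Fintype ι] in
/-- Meet and join of two updated base points ordered off the updated coordinate. [folklore] -/
theorem update_inf_sup_update {c c' : ι → ℝ} {i : ι} (hle : ∀ k, k ≠ i → c' k ≤ c k) {r t : ℝ} (hrt : r ≤ t) :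
    update c i r ⊓ update c' i t = update c' i r ∧ update c i r ⊔ update c' i t = update c i t := by
  constructor
  · funext k
    by_cases hk : k = i
    · subst hk; simp [hrt]
    · simp [update_of_ne hk, hle k hk]
  · funext k
    by_cases hk : k = i
    · subst hk; simp [hrt]
    · simp [update_of_ne hk, hle k hk]

omit [Fintype ι] in
/-- **Increasing differences along direction `i`**: if the pair `(c, c')` is generic in direction `i` for `ψ` and
`c' ≤ c` off `i`, the profile `s ↦ exp(ψ(c; i := s) − ψ(c'; i := s))` is non-decreasing on almost every comparable
pair of reals. [this work] -/
theorem ae_monotone_lineProfile {ψ : (ι → ℝ) → ℝ} {c c' : ι → ℝ} {i : ι} (hle : ∀ k, k ≠ i → c' k ≤ c k)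
    (h : ∀ᵐ rt ∂(volume : Measure ℝ).prod (volume : Measure ℝ),
      ψ (update c i rt.1) + ψ (update c' i rt.2) ≤
        ψ (update c i rt.1 ⊓ update c' i rt.2) + ψ (update c i rt.1 ⊔ update c' i rt.2)) :
    ∀ᵐ rt ∂(volume : Measure ℝ).prod (volume : Measure ℝ), rt.1 ≤ rt.2 →
      ENNReal.ofReal (Real.exp (ψ (update c i rt.1) - ψ (update c' i rt.1))) ≤
        ENNReal.ofReal (Real.exp (ψ (update c i rt.2) - ψ (update c' i rt.2))) := by
  filter_upwards [h] with rt hrt hle'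
  rw [(update_inf_sup_update hle hle').1, (update_inf_sup_update hle hle').2] at hrt
  exact ENNReal.ofReal_le_ofReal (Real.exp_le_exp.2 (by linarith))

/-- **The line factor of a pair generic in direction `i` is non-decreasing on almost every comparable pair of `ℝ^ι`.**
[this work] -/
theorem ae_monotone_lineFactor {ψ : (ι → ℝ) → ℝ} {c c' : ι → ℝ} {i : ι} (hle : ∀ k, k ≠ i → c' k ≤ c k)
    (h : ∀ᵐ rt ∂(volume : Measure ℝ).prod (volume : Measure ℝ),
      ψ (update c i rt.1) + ψ (update c' i rt.2) ≤
        ψ (update c i rt.1 ⊓ update c' i rt.2) + ψ (update c i rt.1 ⊔ update c' i rt.2)) :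
    ∀ᵐ p ∂(volume : Measure (ι → ℝ)).prod volume, p.1 ≤ p.2 → lineFactor ψ i c c' p.1 ≤ lineFactor ψ i c c' p.2 := by
  rw [lineFactor_eq_comp_eval]
  exact ae_monotone_comp_eval
    (ℓ := fun s : ℝ => ENNReal.ofReal (Real.exp (ψ (update c i s) - ψ (update c' i s)))) i
    (ae_monotone_lineProfile hle h)

/-- Finiteness of the corner essential suprema of such a line factor. [this work] -/
theorem cornerEssSup_lineFactor_ne_top {ψ : (ι → ℝ) → ℝ} {c c' : ι → ℝ} {i : ι} (hle : ∀ k, k ≠ i → c' k ≤ c k)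
    (h : ∀ᵐ rt ∂(volume : Measure ℝ).prod (volume : Measure ℝ),
      ψ (update c i rt.1) + ψ (update c' i rt.2) ≤
        ψ (update c i rt.1 ⊓ update c' i rt.2) + ψ (update c i rt.1 ⊔ update c' i rt.2))
    (n : ℕ) (p : ι → ℝ) : cornerEssSup (lineFactor ψ i c c') n p ≠ ∞ := by
  rw [lineFactor_eq_comp_eval]
  exact cornerEssSup_comp_eval_ne_top
    (ℓ := fun s : ℝ => ENNReal.ofReal (Real.exp (ψ (update c i s) - ψ (update c' i s)))) i
    (fun _ => ENNReal.ofReal_ne_top) (ae_monotone_lineProfile hle h) n p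

/-- The envelope of such a line factor is finite. [folklore] -/
theorem cornerEnvelope_lineFactor_ne_top {ψ : (ι → ℝ) → ℝ} {c c' : ι → ℝ} {i : ι} (hle : ∀ k, k ≠ i → c' k ≤ c k)
    (h : ∀ᵐ rt ∂(volume : Measure ℝ).prod (volume : Measure ℝ),
      ψ (update c i rt.1) + ψ (update c' i rt.2) ≤
        ψ (update c i rt.1 ⊓ update c' i rt.2) + ψ (update c i rt.1 ⊔ update c' i rt.2))
    (p : ι → ℝ) : cornerEnvelope (lineFactor ψ i c c') p ≠ ∞ :=
  cornerEnvelope_ne_top (cornerEssSup_lineFactor_ne_top hle h 0 p)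

/-- The envelope of such a line factor is non-zero (for measurable `ψ`). [folklore] -/
theorem cornerEnvelope_lineFactor_ne_zero {ψ : (ι → ℝ) → ℝ} (hψ : Measurable ψ) {c c' : ι → ℝ} {i : ι}
    (hle : ∀ k, k ≠ i → c' k ≤ c k)
    (h : ∀ᵐ rt ∂(volume : Measure ℝ).prod (volume : Measure ℝ),
      ψ (update c i rt.1) + ψ (update c' i rt.2) ≤
        ψ (update c i rt.1 ⊓ update c' i rt.2) + ψ (update c i rt.1 ⊔ update c' i rt.2))
    (p : ι → ℝ) : cornerEnvelope (lineFactor ψ i c c') p ≠ 0 :=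
  cornerEnvelope_ne_zero_of_ae_monotone' (measurable_lineFactor hψ i c c') (ae_monotone_lineFactor hle h)
    (lineFactor_ne_zero ψ i c c') p

/-- Positivity of the real value of the envelope. [folklore] -/
theorem toReal_cornerEnvelope_lineFactor_pos {ψ : (ι → ℝ) → ℝ} (hψ : Measurable ψ) {c c' : ι → ℝ} {i : ι}
    (hle : ∀ k, k ≠ i → c' k ≤ c k)
    (h : ∀ᵐ rt ∂(volume : Measure ℝ).prod (volume : Measure ℝ),
      ψ (update c i rt.1) + ψ (update c' i rt.2) ≤
        ψ (update c i rt.1 ⊓ update c' i rt.2) + ψ (update c i rt.1 ⊔ update c' i rt.2))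
    (p : ι → ℝ) : 0 < (cornerEnvelope (lineFactor ψ i c c') p).toReal :=
  ENNReal.toReal_pos (cornerEnvelope_lineFactor_ne_zero hψ hle h p) (cornerEnvelope_lineFactor_ne_top hle h p)

/-- **The line correction of the patched function vanishes almost everywhere** (the envelope is a version of the
a.e.-monotone line factor). [this work] -/
theorem lineCorrection_ae_eq_zero {ψ : (ι → ℝ) → ℝ} (hψ : Measurable ψ) {c c' : ι → ℝ} {i : ι}
    (hle : ∀ k, k ≠ i → c' k ≤ c k)
    (h : ∀ᵐ rt ∂(volume : Measure ℝ).prod (volume : Measure ℝ),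
      ψ (update c i rt.1) + ψ (update c' i rt.2) ≤
        ψ (update c i rt.1 ⊓ update c' i rt.2) + ψ (update c i rt.1 ⊔ update c' i rt.2)) :
    ∀ᵐ x ∂(volume : Measure (ι → ℝ)), lineCorrection ψ i c c' x = 0 := by
  filter_upwards [cornerEnvelope_ae_eq (measurable_lineFactor hψ i c c') (ae_monotone_lineFactor hle h)] with x hx
  simp only [lineCorrection]
  rw [hx, toReal_lineFactor, Real.log_exp, sub_self]

/-! ### Locality of the line corrections -/

/-- **Locality of the line correction**: if `φ'` agrees with `φ` at the points `(c; i := s)`, `(c'; i := s)`,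
`s ∈ (pᵢ − rₙ, pᵢ]`, then `Λᵢ^{c,c'}[φ'](p) = Λᵢ^{c,c'}[φ](p)`. [this work] -/
theorem lineCorrection_congr {φ φ' : (ι → ℝ) → ℝ} {i : ι} {c c' p : ι → ℝ} (n : ℕ)
    (h : ∀ s ∈ Ioc (p i - cornerRadius n) (p i),
      φ' (update c i s) = φ (update c i s) ∧ φ' (update c' i s) = φ (update c' i s)) :
    lineCorrection φ' i c c' p = lineCorrection φ i c c' p := by
  have hp : p i ∈ Ioc (p i - cornerRadius n) (p i) := ⟨by linarith [cornerRadius_pos n], le_rfl⟩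
  simp only [lineCorrection, cornerEnvelope_lineFactor_congr n h, (h (p i) hp).1, (h (p i) hp).2]

/-- Locality for the patched function: if the axis sections through `c` and `c'` in direction `i` over
`(pᵢ − rₙ, pᵢ]` lie in `K_j`, then `Λᵢ^{c,c'}[patch φ j](p) = Λᵢ^{c,c'}[φ](p)`. [this work] -/
theorem lineCorrection_patch_eq {φ : (ι → ℝ) → ℝ} {j : (ι → ℚ) × (ι → ℚ)} (hj : ∃ g, IsPatchFn φ j g) {i : ι}
    {c c' p : ι → ℝ} (n : ℕ)
    (hK : ∀ s ∈ Ioc (p i - cornerRadius n) (p i),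
      update c i s ∈ Icc (ratLo j) (ratHi j) ∧ update c' i s ∈ Icc (ratLo j) (ratHi j)) :
    lineCorrection (patch φ j) i c c' p = lineCorrection φ i c c' p :=
  lineCorrection_congr n fun s hs => ⟨patch_eq_of_mem hj (hK s hs).1, patch_eq_of_mem hj (hK s hs).2⟩

/-- **The line correction of `φ` vanishes almost everywhere where the axis sections lie in a box**: for a pair of
base points generic in direction `i` for `patch φ j`, `Λᵢ^{c,c'}[φ](p) = 0` for almost every `p` near which the
two axis sections lie in `K_j`. [this work] -/
theorem lineCorrection_ae_eq_zero_of_patch {φ : (ι → ℝ) → ℝ} (hφ : Measurable φ) {j : (ι → ℚ) × (ι → ℚ)}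
    (hj : ∃ g, IsPatchFn φ j g) {c c' : ι → ℝ} {i : ι} (hle : ∀ k, k ≠ i → c' k ≤ c k)
    (h : PairGenAt (patch φ j) c c') :
    ∀ᵐ p ∂(volume : Measure (ι → ℝ)), (∃ n : ℕ, ∀ s ∈ Ioc (p i - cornerRadius n) (p i),
      update c i s ∈ Icc (ratLo j) (ratHi j) ∧ update c' i s ∈ Icc (ratLo j) (ratHi j)) →
      lineCorrection φ i c c' p = 0 := by
  filter_upwards [lineCorrection_ae_eq_zero (measurable_patch hφ j) hle (h i)] with p hp hex
  obtain ⟨n, hn⟩ := hex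
  rw [← lineCorrection_patch_eq hj n hn, hp]

/-! ### The cocycle identity -/

omit [Fintype ι] in
/-- The line factors multiply along three base points. [folklore] -/
theorem lineFactor_mul_lineFactor (ψ : (ι → ℝ) → ℝ) (i : ι) (c c' c'' x : ι → ℝ) :
    lineFactor ψ i c c' x * lineFactor ψ i c' c'' x = lineFactor ψ i c c'' x := by
  simp only [lineFactor]
  rw [← ENNReal.ofReal_mul (Real.exp_pos _).le, ← Real.exp_add]
  congr 2
  ring

/-- **The cocycle identity for the patched function**: `Λᵢ^{c,c''} = Λᵢ^{c,c'} + Λᵢ^{c',c''}` at EVERY point, for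
three base points decreasing off `i` and pairwise generic in direction `i` (product formula for the envelopes of the
a.e.-monotone line factors). [this work] -/
theorem lineCorrection_add_patch {ψ : (ι → ℝ) → ℝ} (hψ : Measurable ψ) {c c' c'' : ι → ℝ} {i : ι}
    (h1 : ∀ k, k ≠ i → c' k ≤ c k) (h2 : ∀ k, k ≠ i → c'' k ≤ c' k)
    (g1 : ∀ᵐ rt ∂(volume : Measure ℝ).prod (volume : Measure ℝ),
      ψ (update c i rt.1) + ψ (update c' i rt.2) ≤
        ψ (update c i rt.1 ⊓ update c' i rt.2) + ψ (update c i rt.1 ⊔ update c' i rt.2))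
    (g2 : ∀ᵐ rt ∂(volume : Measure ℝ).prod (volume : Measure ℝ),
      ψ (update c' i rt.1) + ψ (update c'' i rt.2) ≤
        ψ (update c' i rt.1 ⊓ update c'' i rt.2) + ψ (update c' i rt.1 ⊔ update c'' i rt.2))
    (p : ι → ℝ) :
    lineCorrection ψ i c c'' p = lineCorrection ψ i c c' p + lineCorrection ψ i c' c'' p := by
  have hprod : cornerEnvelope (lineFactor ψ i c c'') p =
      cornerEnvelope (lineFactor ψ i c c') p * cornerEnvelope (lineFactor ψ i c' c'') p := by
    have e : lineFactor ψ i c c'' = fun x => lineFactor ψ i c c' x * lineFactor ψ i c' c'' x :=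
      funext fun x => (lineFactor_mul_lineFactor ψ i c c' c'' x).symm
    rw [e]
    exact cornerEnvelope_mul_of_ae_monotone (measurable_lineFactor hψ i c' c'') (ae_monotone_lineFactor h2 g2)
      (cornerEssSup_lineFactor_ne_top h1 g1 0 p) (cornerEssSup_lineFactor_ne_top h2 g2 0 p)
  have hpos1 := toReal_cornerEnvelope_lineFactor_pos hψ h1 g1 p
  have hpos2 := toReal_cornerEnvelope_lineFactor_pos hψ h2 g2 p
  simp only [lineCorrection]
  rw [hprod, ENNReal.toReal_mul, Real.log_mul hpos1.ne' hpos2.ne']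
  ring

/-- **The cocycle identity for `φ`**: under the hypotheses of `lineCorrection_add_patch` for `patch φ j`, and if the
three axis sections over `(pᵢ − rₙ, pᵢ]` lie in `K_j`, then `Λᵢ^{c,c''}[φ](p) = Λᵢ^{c,c'}[φ](p) + Λᵢ^{c',c''}[φ](p)`.
[this work] -/
theorem lineCorrection_add {φ : (ι → ℝ) → ℝ} (hφ : Measurable φ) {j : (ι → ℚ) × (ι → ℚ)}
    (hj : ∃ g, IsPatchFn φ j g) {c c' c'' : ι → ℝ} {i : ι}
    (h1 : ∀ k, k ≠ i → c' k ≤ c k) (h2 : ∀ k, k ≠ i → c'' k ≤ c' k)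
    (g1 : PairGenAt (patch φ j) c c') (g2 : PairGenAt (patch φ j) c' c'') {p : ι → ℝ} (n : ℕ)
    (hK : ∀ s ∈ Ioc (p i - cornerRadius n) (p i), update c i s ∈ Icc (ratLo j) (ratHi j) ∧
      update c' i s ∈ Icc (ratLo j) (ratHi j) ∧ update c'' i s ∈ Icc (ratLo j) (ratHi j)) :
    lineCorrection φ i c c'' p = lineCorrection φ i c c' p + lineCorrection φ i c' c'' p := by
  rw [← lineCorrection_patch_eq hj n fun s hs => ⟨(hK s hs).1, (hK s hs).2.2⟩,
    ← lineCorrection_patch_eq hj n fun s hs => ⟨(hK s hs).1, (hK s hs).2.1⟩,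
    ← lineCorrection_patch_eq hj n fun s hs => ⟨(hK s hs).2.1, (hK s hs).2.2⟩]
  exact lineCorrection_add_patch (measurable_patch hφ j) h1 h2 (g1 i) (g2 i) p

/-! ### The plane: tensor splitting of the base correction -/

namespace Plane

/-- In the plane the other coordinate of `0` is `1`. [folklore] -/
theorem forall_ne_zero_iff {P : Fin 2 → Prop} : (∀ k : Fin 2, k ≠ 0 → P k) ↔ P 1 := by
  constructor
  · intro h; exact h 1 (by decide)
  · intro h k hk
    have : k = 1 := by fin_cases k <;> simp_all
    subst this; exact h

/-- In the plane the other coordinate of `1` is `0`. [folklore] -/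
theorem forall_ne_one_iff {P : Fin 2 → Prop} : (∀ k : Fin 2, k ≠ 1 → P k) ↔ P 0 := by
  constructor
  · intro h; exact h 0 (by decide)
  · intro h k hk
    have : k = 0 := by fin_cases k <;> simp_all
    subst this; exact h

/-- **The base factor is the product of the two line factors and a constant** (`|ι| = 2` in
`axisSum_sub_axisSum`). [this work] -/
theorem baseFactor_eq_lineFactor_mul (ψ : (Fin 2 → ℝ) → ℝ) (c c' : Fin 2 → ℝ) :
    baseFactor ψ c c' = fun x => lineFactor ψ 0 c c' x * ENNReal.ofReal (Real.exp (-(ψ c - ψ c'))) *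
      lineFactor ψ 1 c c' x := by
  funext x
  simp only [baseFactor, lineFactor, axisSum_sub_axisSum, Fin.sum_univ_two, Fintype.card_fin]
  rw [← ENNReal.ofReal_mul (Real.exp_pos _).le, ← ENNReal.ofReal_mul (by positivity), ← Real.exp_add,
    ← Real.exp_add]
  congr 2
  push_cast
  ring

/-- The envelope of a constant. [folklore] -/
theorem cornerEnvelope_const (C : ℝ≥0∞) (p : Fin 2 → ℝ) : cornerEnvelope (fun _ : Fin 2 → ℝ => C) p = C :=
  le_antisymm (cornerEnvelope_le_of_ae_le (Eventually.of_forall fun _ _ => le_rfl))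
    (le_cornerEnvelope_of_forall_le (fun _ => le_rfl) p)

/-- **Tensor split of the envelope of the base factor** for a generic pair `c' < c` of base points of `ψ`.
[this work] -/
theorem cornerEnvelope_baseFactor_eq {ψ : (Fin 2 → ℝ) → ℝ} (hψ : Measurable ψ) {c c' : Fin 2 → ℝ}
    (hle : c' ≤ c) (h : PairGenAt ψ c c') (p : Fin 2 → ℝ) :
    cornerEnvelope (baseFactor ψ c c') p = cornerEnvelope (lineFactor ψ 0 c c') p *
      ENNReal.ofReal (Real.exp (-(ψ c - ψ c'))) * cornerEnvelope (lineFactor ψ 1 c c') p := by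
  set C : ℝ≥0∞ := ENNReal.ofReal (Real.exp (-(ψ c - ψ c'))) with hC
  have h0 : ∀ k : Fin 2, k ≠ 0 → c' k ≤ c k := fun k _ => hle k
  have h1 : ∀ k : Fin 2, k ≠ 1 → c' k ≤ c k := fun k _ => hle k
  have hL0fin := cornerEssSup_lineFactor_ne_top h0 (h 0) 0 p
  have hL1fin := cornerEssSup_lineFactor_ne_top h1 (h 1) 0 p
  have hCfin : cornerEssSup (fun _ : Fin 2 → ℝ => C) 0 p ≠ ∞ :=
    ne_top_of_le_ne_top ENNReal.ofReal_ne_top (cornerEssSup_le_of_ae_le (Eventually.of_forall fun _ _ => le_rfl) 0)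
  -- first split off the monotone factor `L₁`
  have hgfin : cornerEssSup (fun x => lineFactor ψ 0 c c' x * C) 0 p ≠ ∞ :=
    ne_top_of_le_ne_top (ENNReal.mul_ne_top hCfin hL0fin) (cornerEssSup_mul_le_mul _ _ 0 p)
  rw [baseFactor_eq_lineFactor_mul,
    cornerEnvelope_mul_of_ae_monotone (measurable_lineFactor hψ 1 c c') (ae_monotone_lineFactor h1 (h 1)) hgfin hL1fin,
    cornerEnvelope_mul_of_ae_monotone measurable_const (Eventually.of_forall fun _ _ => le_rfl) hL0fin hCfin,
    cornerEnvelope_const]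

/-- **The base correction of the patched function is the sum of the two line corrections of `φ`** whenever
`[c', p] ⊆ K_j`, `c' < c < p`. [this work] -/
theorem baseCorrection_patch_eq {φ : (Fin 2 → ℝ) → ℝ} (hφ : Measurable φ) {j : (Fin 2 → ℚ) × (Fin 2 → ℚ)}
    (hj : ∃ g, IsPatchFn φ j g) {c c' p : Fin 2 → ℝ} (hlt : ∀ i, c' i < c i) (hp : ∀ i, c i < p i)
    (h : PairGenAt (patch φ j) c c') (hK : Icc c' p ⊆ Icc (ratLo j) (ratHi j)) :
    baseCorrection (patch φ j) c c' p = lineCorrection φ 0 c c' p + lineCorrection φ 1 c c' p := by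
  set ψ := patch φ j with hψdef
  have hψ : Measurable ψ := measurable_patch hφ j
  have hle : c' ≤ c := fun i => (hlt i).le
  have h0 : ∀ k : Fin 2, k ≠ 0 → c' k ≤ c k := fun k _ => hle k
  have h1 : ∀ k : Fin 2, k ≠ 1 → c' k ≤ c k := fun k _ => hle k
  have hpos0 := toReal_cornerEnvelope_lineFactor_pos hψ h0 (h 0) p
  have hpos1 := toReal_cornerEnvelope_lineFactor_pos hψ h1 (h 1) p
  -- locality: the sections near `p` lie in `K_j`, where `ψ = φ`
  have hsec : ∀ i : Fin 2, ∃ n : ℕ, ∀ s ∈ Ioc (p i - cornerRadius n) (p i),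
      update c i s ∈ Icc (ratLo j) (ratHi j) ∧ update c' i s ∈ Icc (ratLo j) (ratHi j) := by
    intro i
    obtain ⟨n, hn⟩ := (eventually_cornerRadius_lt (sub_pos.2 (hp i))).exists
    refine ⟨n, fun s hs => ⟨hK ⟨fun k => ?_, fun k => ?_⟩, hK ⟨fun k => ?_, fun k => ?_⟩⟩⟩
    · by_cases hk : k = i
      · subst hk; rw [update_self]; have := hs.1; linarith [hlt k]
      · rw [update_of_ne hk]; exact hle k
    · by_cases hk : k = i
      · subst hk; rw [update_self]; exact hs.2
      · rw [update_of_ne hk]; exact (hp k).le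
    · by_cases hk : k = i
      · subst hk; rw [update_self]; have := hs.1; linarith [hlt k]
      · rw [update_of_ne hk]
    · by_cases hk : k = i
      · subst hk; rw [update_self]; exact hs.2
      · rw [update_of_ne hk]; exact ((hlt k).trans (hp k)).le
  have hΛ : ∀ i : Fin 2, lineCorrection φ i c c' p = lineCorrection ψ i c c' p := fun i => by
    obtain ⟨n, hn⟩ := hsec i
    exact (lineCorrection_patch_eq hj n hn).symm
  have hc : ψ c = φ c := patch_eq_of_mem hj (hK ⟨hle, fun i => ((hp i).le)⟩)
  have hc' : ψ c' = φ c' := patch_eq_of_mem hj (hK ⟨le_rfl, fun i => ((hlt i).trans (hp i)).le⟩)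
  rw [hΛ 0, hΛ 1]
  simp only [baseCorrection, lineCorrection]
  rw [cornerEnvelope_baseFactor_eq hψ hle h p, ENNReal.toReal_mul, ENNReal.toReal_mul,
    ENNReal.toReal_ofReal (Real.exp_pos _).le, Real.log_mul (mul_pos hpos0 (Real.exp_pos _)).ne' hpos1.ne',
    Real.log_mul hpos0.ne' (Real.exp_pos _).ne', Real.log_exp, axisSum_sub_axisSum]
  simp only [Fin.sum_univ_two, Fintype.card_fin]
  push_cast
  ring

/-- **The planar shift identity for the boxed versions**: for a generic pair `c' < c` (for `patch φ j`) and
`[c', p] ⊆ K_j`, `c < p`,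
`boxVersion φ c' p = boxVersion φ c p + Λ₀^{c,c'}(p) + Λ₁^{c,c'}(p)`. [this work] -/
theorem boxVersion_shift_eq {φ : (Fin 2 → ℝ) → ℝ} (hφ : Measurable φ) {j : (Fin 2 → ℚ) × (Fin 2 → ℚ)}
    (hj : ∃ g, IsPatchFn φ j g) {c c' p : Fin 2 → ℝ} (hlt : ∀ i, c' i < c i) (hp : ∀ i, c i < p i)
    (hc : GenAt (patch φ j) c) (h : PairGenAt (patch φ j) c c') (hK : Icc c' p ⊆ Icc (ratLo j) (ratHi j)) :
    boxVersion φ c' p = boxVersion φ c p + lineCorrection φ 0 c c' p + lineCorrection φ 1 c c' p := by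
  rw [boxVersion_shift hφ hj hlt hc h hp hK, baseCorrection_patch_eq hφ hj hlt hp h hK, add_assoc]

/-- **The height piece only depends on the heights**: `Λ₀^{c,c'} = Λ₀^{d,d'}` when `c₁ = d₁`, `c'₁ = d'₁`.
[folklore] -/
theorem lineCorrection_zero_congr {φ : (Fin 2 → ℝ) → ℝ} {c c' d d' : Fin 2 → ℝ} (h : c 1 = d 1) (h' : c' 1 = d' 1) :
    lineCorrection φ 0 c c' = lineCorrection φ 0 d d' :=
  lineCorrection_congr_base (forall_ne_zero_iff.2 h) (forall_ne_zero_iff.2 h')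

/-- **The abscissa piece only depends on the abscissae**: `Λ₁^{c,c'} = Λ₁^{d,d'}` when `c₀ = d₀`, `c'₀ = d'₀`.
[folklore] -/
theorem lineCorrection_one_congr {φ : (Fin 2 → ℝ) → ℝ} {c c' d d' : Fin 2 → ℝ} (h : c 0 = d 0) (h' : c' 0 = d' 0) :
    lineCorrection φ 1 c c' = lineCorrection φ 1 d d' :=
  lineCorrection_congr_base (forall_ne_one_iff.2 h) (forall_ne_one_iff.2 h')

end Plane

end Summit.CriticalPhenomena.PercolationContinuityZ3.Theorems.SahiAEFourFunctions
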